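import Summits.HodgeConjecture.CorCM.CyclicCMTypesClassification
import Mathlib.RingTheory.ZMod.UnitsCyclic
import HarnessLib

/-!
# `ℚ(ζ_{p^k})`, `p` an odd prime, `k ≥ 2`: every primitive CM type is nondegenerate ⟺ `k = 2` and `p` is a Fermat
# prime — else simple CM abelian varieties of dimension `p^{k−1}(p−1)/2` with exceptional Hodge classes

COR-CM (cell `pub-hodgecm2`), binder seat b04 (gen 12), count-neutral; instance layer of the classification for
cyclic Galois groups (`CorCM/CyclicCMTypesClassification.lean`, `forall_isPrimitive_isNondegenerate_iff_of_isCyclic`)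
on the prime-power cyclotomic fields, whose Galois group `(ℤ/p^k)ˣ` is CYCLIC of order `p^{k−1}(p−1)` (Gauss;
Mathlib `ZMod.isCyclic_units_of_prime_pow`).  KERNEL ONLY: theorems; no definition, no named fact, no `sorry`.

Write `p − 1 = 2^{a+1} m` with `m` odd.  The odd part of `p^{k−1}(p−1)` is `m p^{k−1}`, which for `k ≥ 2` is `1` or
a prime exactly when `m = 1` and `k = 2`.  Hence:

* `forall_isPrimitive_isNondegenerate_iff_of_prime_pow` — for `L = ℚ(ζ_{p^k})`, `k ≥ 2`: every primitive CM type
  of `L` is nondegenerate ⟺ `k = 2 ∧ m = 1` (`p` a FERMAT prime): `ℚ(ζ₉)`, `ℚ(ζ₂₅)`, `ℚ(ζ₂₈₉)`, `ℚ(ζ_{65537²})` on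
  one side; `ℚ(ζ₂₇)`, `ℚ(ζ₄₉)`, `ℚ(ζ₈₁)`, `ℚ(ζ₁₂₁)`, `ℚ(ζ₁₂₅)`, … on the other;
* `hodgeConjectureFor_pow_of_isSimple_of_prime_sq` — `p` a Fermat prime: the Hodge conjecture for every power of
  every SIMPLE abelian variety with CM by `ℚ(ζ_{p²})` (dimension `p(p−1)/2`), UNCONDITIONALLY — e.g.
  `hodgeConjectureFor_pow_of_isSimple_twentyFive` (simple CM abelian `10`-folds with CM by `ℚ(ζ₂₅)`);
* `exists_simple_exceptional_realisation_of_prime_pow` — otherwise (`k ≥ 3`, or `m > 1`) there are SIMPLE abelian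
  varieties of dimension `p^{k−1}(p−1)/2` with CM by `ℚ(ζ_{p^k})` carrying a rational `(r,r)`-class outside
  `Dʳ ⊗ ℂ` on some power — e.g. `exists_simple_exceptional_realisation_twentySeven` (dimension `9`).

## References

* [Washington1997] L. C. Washington, *Introduction to Cyclotomic Fields*, Thm. 2.5, Prop. 2.7 (degree `φ(n)`;
  Galois group `(ℤ/n)ˣ`).
* [Kubota1965] T. Kubota, *On the field extension by complex multiplication*, Trans. AMS 118 (1965), §4 Lemma 2.
* [Dodson1984] B. Dodson, *The structure of Galois groups of CM-fields*, Trans. AMS 283 (1984), §3.2.1.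
* [Gordon1999HodgeAVSurvey] B. B. Gordon, *A survey of the Hodge conjecture for abelian varieties*, Thm. 6.4, §9.4.
-/

noncomputable section

open CategoryTheory CategoryTheory.Limits NumberField Polynomial

namespace Summit.HodgeConjecture.CorCM.CyclicComposite

open Literature.NumberTheory.ComplexMultiplication
open Literature.AlgebraicGeometry.Motives (AbelianVariety CMType)
open Literature.AlgebraicGeometry.HodgeTheory
open Literature.AlgebraicGeometry.ComplexMultiplication (IsCMTypeRealisation)
open Literature.Barriers.HodgeConjecture (divisorClassesSpan)
open Literature.AlgebraicGeometry.Pohlmann1968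
open Summit.HodgeConjecture.CorCM.CyclicTwoPower (isNondegenerate_of_isPrimitive_of_isCyclic)

section PrimePower

variable {L : Type} [Field L] [NumberField L]

/-- **`ℚ(ζ_{p^k})`, `p` an odd prime, `k ≥ 1`: CM, normal, CYCLIC Galois group of order `p^{k−1}(p−1)`.**
[cite: Washington1997, Thm. 2.5, Prop. 2.7] -/
theorem cm_normal_cyclic_finrank_of_prime_pow {p k : ℕ} (hp : p.Prime) (hp2 : p ≠ 2) (hk : 0 < k)
    (L : Type) [Field L] [NumberField L] [IsCyclotomicExtension {p ^ k} ℚ L] :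
    IsCMField L ∧ Normal ℚ L ∧ IsCyclic (L ≃ₐ[ℚ] L) ∧ Module.finrank ℚ L = p ^ (k - 1) * (p - 1) := by
  haveI : NeZero (p ^ k) := ⟨pow_ne_zero k hp.ne_zero⟩
  have h3 : 3 ≤ p := by have := hp.two_le; omega
  have h2 : 2 < p ^ k :=
    lt_of_lt_of_le (by omega) (le_trans (le_of_eq (pow_one p).symm) (Nat.pow_le_pow_right hp.pos hk))
  have hirr : Irreducible (cyclotomic (p ^ k) ℚ) := cyclotomic.irreducible_rat (by positivity)
  haveI := IsCyclotomicExtension.isGalois {p ^ k} ℚ L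
  exact ⟨IsCyclotomicExtension.Rat.isCMField L (S := ({p ^ k} : Set ℕ)) ⟨p ^ k, rfl, h2⟩, inferInstance,
    (MulEquiv.isCyclic (IsCyclotomicExtension.autEquivPow L hirr)).2 (ZMod.isCyclic_units_of_prime_pow p hp hp2 k),
    by rw [IsCyclotomicExtension.finrank L hirr, Nat.totient_prime_pow hp hk]⟩

/-- A prime `p` with `p − 1 = 2^{a+1} m`, `m ≥ 1`, is odd. [folklore] -/
private theorem ne_two_of_sub_one_eq {p a m : ℕ} (hm : 0 < m) (hpam : p - 1 = 2 ^ (a + 1) * m) : p ≠ 2 := by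
  rintro rfl
  have h1 : 2 ≤ 2 ^ (a + 1) := by
    calc 2 = 2 ^ 1 := (pow_one 2).symm
      _ ≤ 2 ^ (a + 1) := Nat.pow_le_pow_right (by norm_num) (by omega)
  have h2 : 2 ^ (a + 1) ≤ 2 ^ (a + 1) * m := Nat.le_mul_of_pos_right _ hm
  omega

/-- Arithmetic of the odd part: for `p` prime, `k ≥ 2`, `m ≥ 1`: `m p^{k−1}` is prime iff `m = 1` and `k = 2`, and it
is never `1`. [folklore] -/
theorem mul_prime_pow_prime_iff {p k m : ℕ} (hp : p.Prime) (hk : 2 ≤ k) (hm : 0 < m) :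
    ((m * p ^ (k - 1) = 1 ∨ (m * p ^ (k - 1)).Prime) ↔ (k = 2 ∧ m = 1)) := by
  have h2p := hp.two_le
  have hpk : p ≤ p ^ (k - 1) := by
    calc p = p ^ 1 := (pow_one p).symm
      _ ≤ p ^ (k - 1) := Nat.pow_le_pow_right hp.pos (by omega)
  constructor
  · rintro (h1 | hpr)
    · exfalso
      have : p ^ (k - 1) ≤ m * p ^ (k - 1) := Nat.le_mul_of_pos_left _ hm
      omega
    · rcases Nat.prime_mul_iff.1 hpr with ⟨-, hpow⟩ | ⟨hpow, rfl⟩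
      · exfalso
        rw [hpow] at hpk
        omega
      · refine ⟨?_, rfl⟩
        -- `p ∣ p^{k-1}` prime ⟹ `p^{k-1} = p` ⟹ `k - 1 = 1`
        rcases hpow.eq_one_or_self_of_dvd p (dvd_pow_self p (by omega)) with h1 | h2
        · omega
        · have h3 : (1 : ℕ) = k - 1 := Nat.pow_right_injective h2p (show p ^ 1 = p ^ (k - 1) by rw [pow_one]; exact h2)
          omega
  · rintro ⟨rfl, rfl⟩
    exact Or.inr (by simpa using hp)

/-- **`ℚ(ζ_{p^k})`, `k ≥ 2`, `p − 1 = 2^{a+1} m` (`m` odd): every primitive CM type is nondegenerate ⟺ `k = 2` and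
`m = 1` (`p` a Fermat prime).** [cite: Kubota1965, §4 Lemma 2] [cite: Dodson1984, §3.2.1]
[cite: Washington1997, Thm. 2.5] -/
theorem forall_isPrimitive_isNondegenerate_iff_of_prime_pow {p k a m : ℕ} (hp : p.Prime) (hk : 2 ≤ k)
    (hm : Odd m) (hpam : p - 1 = 2 ^ (a + 1) * m) [IsCyclotomicExtension {p ^ k} ℚ L] :
    (∀ (Φ : CMType L) (φ₀ : L →+* ℂ), IsPrimitive (ℂ ≃+* ℂ) Φ.1 φ₀ → IsNondegenerate Φ) ↔ (k = 2 ∧ m = 1) := by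
  have hp2 : p ≠ 2 := ne_two_of_sub_one_eq hm.pos hpam
  obtain ⟨hcm, hno, hcyc, hL⟩ := cm_normal_cyclic_finrank_of_prime_pow (k := k) hp hp2 (by omega) L
  have hL' : Module.finrank ℚ L = 2 ^ (a + 1) * (m * p ^ (k - 1)) := by
    rw [hL, hpam]; ring
  have hodd : Odd (m * p ^ (k - 1)) := Nat.odd_mul.2 ⟨hm, (hp.odd_of_ne_two hp2).pow⟩
  rw [forall_isPrimitive_isNondegenerate_iff_of_isCyclic hcyc hodd hL', mul_prime_pow_prime_iff hp hk hm.pos]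

variable {Φ : CMType L} {A : AbelianVariety ℂ} {ι : 𝓞 L →+* End A} {θ : L →+* Module.End ℂ (complexBetti A.X 1)}

/-- **`p` a FERMAT prime (`p − 1 = 2^{a+1}`): the Hodge conjecture for every power of every SIMPLE abelian variety
with CM by `ℚ(ζ_{p²})`** (cyclic Galois group of order `2^{a+1} p`) — UNCONDITIONAL.
[cite: Gordon1999HodgeAVSurvey, Thm. 6.4 and §9.3] [cite: Kubota1965, §4 Lemma 2] -/
theorem hodgeConjectureFor_pow_of_isSimple_of_prime_sq {p a : ℕ} (hp : p.Prime) (hpa : p - 1 = 2 ^ (a + 1))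
    [IsCyclotomicExtension {p ^ 2} ℚ L] (hA : IsCMTypeRealisation Φ A ι θ) (hsimple : A.IsSimple) (n : ℕ) :
    HodgeConjectureFor (⨁ fun _ : Fin n => A).dim (⨁ fun _ : Fin n => A).X := by
  have hp2 : p ≠ 2 := ne_two_of_sub_one_eq (m := 1) one_pos (by rw [hpa, mul_one])
  obtain ⟨hcm, hno, hcyc, hL⟩ := cm_normal_cyclic_finrank_of_prime_pow hp hp2 (by norm_num : 0 < 2) L
  have hL' : Module.finrank ℚ L = 2 ^ (a + 1) * p := by rw [hL, hpa]; ring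
  obtain ⟨s₀⟩ := (inferInstance : Nonempty (L →+* ℂ))
  exact (isNondegenerate_of_isPrimitive_of_isCyclic hcyc hp hp2 hL' Φ s₀
    ((Literature.AlgebraicGeometry.ComplexMultiplication.isSimple_iff_isPrimitive hA s₀).1 hsimple)).hodgeConjectureFor_pow
    hA n

/-- **`ℚ(ζ₂₅)`**: the Hodge conjecture for every power of every simple abelian `10`-fold with CM by `ℚ(ζ₂₅)` —
UNCONDITIONAL. [cite: Gordon1999HodgeAVSurvey, Thm. 6.4 and §9.3] -/
theorem hodgeConjectureFor_pow_of_isSimple_twentyFive [IsCyclotomicExtension {25} ℚ L]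
    (hA : IsCMTypeRealisation Φ A ι θ) (hsimple : A.IsSimple) (n : ℕ) :
    HodgeConjectureFor (⨁ fun _ : Fin n => A).dim (⨁ fun _ : Fin n => A).X := by
  haveI : IsCyclotomicExtension {5 ^ 2} ℚ L := by show IsCyclotomicExtension {25} ℚ L; infer_instance
  exact hodgeConjectureFor_pow_of_isSimple_of_prime_sq (p := 5) (a := 1) (by norm_num) (by norm_num) hA hsimple n

/-- **`ℚ(ζ_{p^k})` with `k ≥ 3` or `m > 1`: SIMPLE CM abelian varieties of dimension `p^{k−1}(p−1)/2` with an
exceptional Hodge class on some power EXIST** (the inflated block type for the divisor `l = p` resp. `l ∣ m` of the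
odd part `m p^{k−1}`; realisations by `cmAbelianVarietyRealised_holds`). [cite: Dodson1984, §3.2.1]
[cite: Gordon1999HodgeAVSurvey, §9.4] -/
theorem exists_simple_exceptional_realisation_of_prime_pow {p k a m : ℕ} (hp : p.Prime) (hk : 2 ≤ k) (hm : Odd m)
    (hpam : p - 1 = 2 ^ (a + 1) * m) (hkm : 3 ≤ k ∨ 1 < m) [IsCyclotomicExtension {p ^ k} ℚ L] :
    ∃ (Φ : CMType L) (A : AbelianVariety ℂ) (ι : 𝓞 L →+* End A)
      (θ : L →+* Module.End ℂ (complexBetti A.X 1)),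
      IsCMTypeRealisation Φ A ι θ ∧ A.IsSimple ∧ A.dim = 2 ^ a * (m * p ^ (k - 1)) ∧ ¬IsNondegenerate Φ ∧
      ∃ n r : ℕ, ∃ c : complexBetti (⨁ fun _ : Fin n => A).X (2 * r), IsRationalClass c ∧
        IsOfHodgeType (⨁ fun _ : Fin n => A).dim (⨁ fun _ : Fin n => A).X (2 * r) r r c ∧
        c ∉ divisorClassesSpan (⨁ fun _ : Fin n => A).X (⨁ fun _ : Fin n => A).dim r := by
  have hp2 : p ≠ 2 := ne_two_of_sub_one_eq hm.pos hpam
  obtain ⟨hcm, hno, hcyc, hL⟩ := cm_normal_cyclic_finrank_of_prime_pow (k := k) hp hp2 (by omega) L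
  have hL' : Module.finrank ℚ L = 2 ^ (a + 1) * (m * p ^ (k - 1)) := by rw [hL, hpam]; ring
  have hodd : Odd (m * p ^ (k - 1)) := Nat.odd_mul.2 ⟨hm, (hp.odd_of_ne_two hp2).pow⟩
  have hp0 := hp.pos
  have hpk : p ≤ p ^ (k - 1) := by
    calc p = p ^ 1 := (pow_one p).symm
      _ ≤ p ^ (k - 1) := Nat.pow_le_pow_right hp.pos (by omega)
  -- the divisor `l = p` of the odd part `m p^{k-1}`, proper because `k ≥ 3` or `m > 1`
  refine exists_simple_exceptional_realisation_of_isCyclic hcyc hodd (l := p) ⟨m * p ^ (k - 2), ?_⟩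
    hp.two_le ?_ hL'
  · rw [show k - 1 = (k - 2) + 1 by omega, pow_succ]; ring
  · rcases hkm with hk3 | hm1
    · have hpp : p * p ≤ p ^ (k - 1) := by
        calc p * p = p ^ 2 := (sq p).symm
          _ ≤ p ^ (k - 1) := Nat.pow_le_pow_right hp.pos (by omega)
      have hlt : p < p * p := by nlinarith [hp.two_le]
      calc p < p * p := hlt
        _ ≤ p ^ (k - 1) := hpp
        _ ≤ m * p ^ (k - 1) := Nat.le_mul_of_pos_left _ hm.pos
    · calc p < 2 * p := by omega
        _ ≤ m * p := Nat.mul_le_mul_right _ hm1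
        _ ≤ m * p ^ (k - 1) := Nat.mul_le_mul_left _ hpk

/-- **`ℚ(ζ₂₇)` (`18 = 2·9`)**: simple CM abelian `9`-folds with CM by `ℚ(ζ₂₇)` carrying exceptional Hodge classes
exist. [cite: Dodson1984, §3.2.1] -/
theorem exists_simple_exceptional_realisation_twentySeven [IsCyclotomicExtension {27} ℚ L] :
    ∃ (Φ : CMType L) (A : AbelianVariety ℂ) (ι : 𝓞 L →+* End A)
      (θ : L →+* Module.End ℂ (complexBetti A.X 1)),
      IsCMTypeRealisation Φ A ι θ ∧ A.IsSimple ∧ A.dim = 9 ∧ ¬IsNondegenerate Φ ∧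
      ∃ n r : ℕ, ∃ c : complexBetti (⨁ fun _ : Fin n => A).X (2 * r), IsRationalClass c ∧
        IsOfHodgeType (⨁ fun _ : Fin n => A).dim (⨁ fun _ : Fin n => A).X (2 * r) r r c ∧
        c ∉ divisorClassesSpan (⨁ fun _ : Fin n => A).X (⨁ fun _ : Fin n => A).dim r := by
  haveI : IsCyclotomicExtension {3 ^ 3} ℚ L := by show IsCyclotomicExtension {27} ℚ L; infer_instance
  obtain ⟨Φ, A, ι, θ, hA, hs, hdim, hdeg, hexc⟩ := exists_simple_exceptional_realisation_of_prime_pow (L := L)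
    (p := 3) (k := 3) (a := 0) (m := 1) (by norm_num) (by norm_num) (by decide) (by norm_num) (Or.inl le_rfl)
  exact ⟨Φ, A, ι, θ, hA, hs, by norm_num at hdim; exact hdim, hdeg, hexc⟩

end PrimePower

end Summit.HodgeConjecture.CorCM.CyclicComposite

end
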